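import Mathlib

/-!
# `MatrixDescartes` census — rank-one `(2,K)₁`: the LONE-LETTER STRIP and the SLOPE LAWS of the two-letter profiles
# (exact structural lemmas for the per-side programme: uniqueness of critical directions on each weight ray; slope `> 1` past a letter,
# slope bound before a letter, monotone exchange)

HONEST FRAMING.  Object-search cell `pub-symmetroid`, seat `val-sym-mdr-p1` (generation 21); helper file `--supports` the crux item
stmt-ValiantsHypothesis-18050 (`Theses.LacunarySymmetroid.MatrixDescartes`, OPEN, on HOLD) with NO closure claim.  Companion of
`…PivotRankOneCriticalWindows` (localisation), `…CriticalWindowsThree` (K = 3 elimination), `…CriticalWindowsSandwich` / `…WindowTest` (two-scale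
dictionary).  Pure real algebra; no count is proved.  Nothing here bears on `MatrixDescartes` in its window, on `DoorA26` / `DoorA34`, registers /
credences, or `VP ≠ VNP`.

SETTING.  Pivot letter `0` at `t₀ > 0` (rate `−a`), upper letters at `tₖ` (rates `bₖ`), point weights `Wₖ = wₖx^{dₖ} > 0` on the weight ray of a fixed
`x`; direction `T`.  Critical equations of the window profile: `∂_T`: `Σₖ Wₖ(T² − tₖ²) = 0`; `x∂ₓ`: `a W₀ (T−t₀)² = Σ_{k≥1} bₖ Wₖ (T−tₖ)²`.
* §1 `dirEq_strictMono` — `T ↦ Σₖ Wₖ(T² − tₖ²)` is strictly increasing on `T > 0`: on every weight ray there is AT MOST ONE `T`-critical direction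
  (`dirCritical_unique`).
* §2 **LONE-LETTER STRIP** (`tᵢ < t₀` for the letters `i ∈ s` on the left, ONE letter `j` with `tⱼ > t₀` on the right, directions `t₀ < T < tⱼ`):
  `xRatio_strictAnti` — the ratio `[Σᵢ bᵢWᵢ(T−tᵢ)² + bⱼWⱼ(T−tⱼ)²]/(aW₀(T−t₀)²)` is strictly DECREASING in `T` on the strip (each
  `((T−tₖ)/(T−t₀))²` is), hence `xCritical_unique_in_strip`: on every weight ray there is at most one `x`-critical direction in the strip.  READING
  (seat memo PROFILE-GAUGE.md §2): in a lone-letter strip BOTH critical curves are graphs over the weight ray, the best response `s*(ψ)` is a strictly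
  increasing bijection of the strip onto a ray, and the critical points of the profile are the parameters where the two unique roots coincide — the
  located LONE-LETTER LAW says this happens at most twice.
* §3 **SLOPE LAWS** for the logarithmic slope `Sₖ(T) = θₖ(T+t₀)/(T−t₀) + (1−θₖ)(T+tₖ)/(T−tₖ)` of the two-letter profile `gₖ` (`= T·(log gₖ)′(T)`,
  `= θₖcoth((ψ−τ₀)/2) + (1−θₖ)coth((ψ−τₖ)/2)`; `θₖ = bₖ/(a+bₖ) ∈ (0,1)`): `slope_gt_one_past` (`Sₖ > 1` for `T > max(t₀,tₖ)`), `slope_lt_before`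
  (`Sₖ < θₖ(T+t₀)/(T−t₀) − (1−θₖ)` for `t₀ < T < tₖ`), **`slope_exchange`** (`Sⱼ − Sₖ > 2(1−θₖ) − 2θₖt₀/(T−t₀)` for `t₀ < tⱼ < T < tₖ`) and
  `slope_exchange_pos` (hence `Sⱼ > Sₖ` once `(1−θₖ)T ≥ t₀`, i.e. `T ≥ t₀(a+bₖ)/a`): past its own position a letter's two-letter profile gains
  monotonically on every later letter's, outside an explicit neighbourhood of the pivot letter — the exact form of the tropical «slope-1 dominance»
  behind the located per-side / same-side laws.
[folklore] Elementary real inequalities.  No definitions, no named facts.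
-/

-- `Summit.ValiantsHypothesis.ValiantsHypothesis.…` repeats a component by the D-0017 layout
-- (single-conjunct summit), which the `dupNamespace` linter flags; the name is mandated.
set_option linter.dupNamespace false

namespace Summit.ValiantsHypothesis.ValiantsHypothesis.Theorems.LacunarySymmetroidMatrixDescartes.Pivot.CriticalWindows.Strip

open Finset
open scoped BigOperators

/-! ## 1. At most one `T`-critical direction on each weight ray -/

/-- **THE `∂_T`-EQUATION IS MONOTONE.**  For positive weights, `0 < T₁ < T₂ ⇒ Σₖ Wₖ(T₁² − tₖ²) < Σₖ Wₖ(T₂² − tₖ²)`. [folklore] -/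
theorem dirEq_strictMono {ι : Type*} (s : Finset ι) (hs : s.Nonempty) (W t : ι → ℝ) (hW : ∀ k ∈ s, 0 < W k)
    {T₁ T₂ : ℝ} (h1 : 0 < T₁) (h12 : T₁ < T₂) :
    ∑ k ∈ s, W k * (T₁ ^ 2 - t k ^ 2) < ∑ k ∈ s, W k * (T₂ ^ 2 - t k ^ 2) := by
  apply Finset.sum_lt_sum_of_nonempty hs
  intro k hk
  have : T₁ ^ 2 < T₂ ^ 2 := by nlinarith
  exact mul_lt_mul_of_pos_left (by linarith) (hW k hk)

/-- **AT MOST ONE `T`-CRITICAL DIRECTION per weight ray.** [folklore] -/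
theorem dirCritical_unique {ι : Type*} (s : Finset ι) (hs : s.Nonempty) (W t : ι → ℝ) (hW : ∀ k ∈ s, 0 < W k)
    {T₁ T₂ : ℝ} (h1 : 0 < T₁) (h2 : 0 < T₂)
    (e1 : ∑ k ∈ s, W k * (T₁ ^ 2 - t k ^ 2) = 0) (e2 : ∑ k ∈ s, W k * (T₂ ^ 2 - t k ^ 2) = 0) : T₁ = T₂ := by
  by_contra hne
  rcases lt_or_gt_of_ne hne with hlt | hgt
  · have := dirEq_strictMono s hs W t hW h1 hlt; linarith
  · have := dirEq_strictMono s hs W t hW h2 hgt; linarith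

/-! ## 2. The lone-letter strip: at most one `x`-critical direction on each weight ray -/

/-- Elementary: for `tᵢ < t₀ < T < T'`, `(T−tᵢ)(T'−t₀) > (T'−tᵢ)(T−t₀)` — the ratio `(T−tᵢ)/(T−t₀)` decreases in `T`. [folklore] -/
theorem ratio_left_decreasing {ti t₀ T T' : ℝ} (hi : ti < t₀) (hTT : T < T') :
    (T' - ti) * (T - t₀) < (T - ti) * (T' - t₀) := by nlinarith

/-- Elementary: for `t₀ < T < T' < tⱼ`, `(tⱼ−T)(T'−t₀) > (tⱼ−T')(T−t₀)` — the ratio `(tⱼ−T)/(T−t₀)` decreases in `T`. [folklore] -/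
theorem ratio_right_decreasing {tj t₀ T T' : ℝ} (hT : t₀ < T) (hTT : T < T') (hj : T' < tj) :
    (tj - T') * (T - t₀) < (tj - T) * (T' - t₀) := by nlinarith

/-- Squares of positive quantities compare like the quantities. [folklore] -/
theorem sq_ratio_lt {p q p' q' : ℝ} (hq : 0 < q) (hp' : 0 ≤ p') (h : p' * q < p * q') :
    p' ^ 2 * q ^ 2 < p ^ 2 * q' ^ 2 := by
  have h1 : 0 ≤ p' * q := mul_nonneg hp' hq.le
  have h3 : (p' * q) ^ 2 < (p * q') ^ 2 := by nlinarith
  nlinarith [h3]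

/-- **THE `x`-CRITICAL RATIO IS STRICTLY DECREASING ON A LONE-LETTER STRIP** (cross-multiplied form).  Letters `i ∈ s` on the left (`tᵢ < t₀`), one
letter `j` on the right (`tⱼ > t₀`), positive rates and weights, directions `t₀ < T < T' < tⱼ`:
`[Σᵢ bᵢWᵢ(T'−tᵢ)² + bⱼWⱼ(T'−tⱼ)²]·(T−t₀)² < [Σᵢ bᵢWᵢ(T−tᵢ)² + bⱼWⱼ(T−tⱼ)²]·(T'−t₀)²`. [folklore] -/
theorem xRatio_strictAnti {ι : Type*} (s : Finset ι) (t₀ tj bj Wj T T' : ℝ) (b W t : ι → ℝ)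
    (hb : ∀ i ∈ s, 0 < b i) (hW : ∀ i ∈ s, 0 < W i) (ht : ∀ i ∈ s, t i < t₀) (hbj : 0 < bj) (hWj : 0 < Wj)
    (hT : t₀ < T) (hTT : T < T') (hj : T' < tj) :
    (∑ i ∈ s, b i * W i * (T' - t i) ^ 2 + bj * Wj * (T' - tj) ^ 2) * (T - t₀) ^ 2
      < (∑ i ∈ s, b i * W i * (T - t i) ^ 2 + bj * Wj * (T - tj) ^ 2) * (T' - t₀) ^ 2 := by
  have h0 : 0 < T - t₀ := by linarith
  -- the `j`-term strictly
  have hjterm : (T' - tj) ^ 2 * (T - t₀) ^ 2 < (T - tj) ^ 2 * (T' - t₀) ^ 2 := by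
    have e1 : (T' - tj) ^ 2 = (tj - T') ^ 2 := by ring
    have e2 : (T - tj) ^ 2 = (tj - T) ^ 2 := by ring
    rw [e1, e2]
    exact sq_ratio_lt h0 (by linarith) (ratio_right_decreasing hT hTT hj)
  -- the left terms (weakly: the sum may be empty)
  have hiterm : ∀ i ∈ s, b i * W i * (T' - t i) ^ 2 * (T - t₀) ^ 2 ≤ b i * W i * (T - t i) ^ 2 * (T' - t₀) ^ 2 := by
    intro i hi
    have hlt : (T' - t i) ^ 2 * (T - t₀) ^ 2 < (T - t i) ^ 2 * (T' - t₀) ^ 2 :=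
      sq_ratio_lt h0 (by linarith [ht i hi]) (ratio_left_decreasing (ht i hi) hTT)
    have hbw : 0 < b i * W i := mul_pos (hb i hi) (hW i hi)
    nlinarith
  have hsum : (∑ i ∈ s, b i * W i * (T' - t i) ^ 2) * (T - t₀) ^ 2 ≤ (∑ i ∈ s, b i * W i * (T - t i) ^ 2) * (T' - t₀) ^ 2 := by
    rw [Finset.sum_mul, Finset.sum_mul]
    exact Finset.sum_le_sum hiterm
  have hbw : 0 < bj * Wj := mul_pos hbj hWj
  nlinarith

/-- **AT MOST ONE `x`-CRITICAL DIRECTION IN A LONE-LETTER STRIP per weight ray.**  If two directions `T, T' ∈ (t₀, tⱼ)` on the same weight ray both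
satisfy the `x`-critical equation `aW₀(T−t₀)² = Σᵢ bᵢWᵢ(T−tᵢ)² + bⱼWⱼ(T−tⱼ)²`, they coincide. [folklore] -/
theorem xCritical_unique_in_strip {ι : Type*} (s : Finset ι) (a t₀ tj bj W₀ Wj T T' : ℝ) (b W t : ι → ℝ)
    (hb : ∀ i ∈ s, 0 < b i) (hW : ∀ i ∈ s, 0 < W i) (ht : ∀ i ∈ s, t i < t₀) (hbj : 0 < bj) (hWj : 0 < Wj)
    (hT : t₀ < T) (hTj : T < tj) (hT' : t₀ < T') (hT'j : T' < tj)
    (e1 : a * W₀ * (T - t₀) ^ 2 = ∑ i ∈ s, b i * W i * (T - t i) ^ 2 + bj * Wj * (T - tj) ^ 2)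
    (e2 : a * W₀ * (T' - t₀) ^ 2 = ∑ i ∈ s, b i * W i * (T' - t i) ^ 2 + bj * Wj * (T' - tj) ^ 2) : T = T' := by
  by_contra hne
  rcases lt_or_gt_of_ne hne with hlt | hgt
  · have h := xRatio_strictAnti s t₀ tj bj Wj T T' b W t hb hW ht hbj hWj hT hlt hT'j
    rw [← e1, ← e2] at h
    -- `aW₀(T'−t₀)²(T−t₀)² < aW₀(T−t₀)²(T'−t₀)²`: impossible
    have : a * W₀ * (T' - t₀) ^ 2 * (T - t₀) ^ 2 = a * W₀ * (T - t₀) ^ 2 * (T' - t₀) ^ 2 := by ring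
    linarith
  · have h := xRatio_strictAnti s t₀ tj bj Wj T' T b W t hb hW ht hbj hWj hT' hgt hTj
    rw [← e1, ← e2] at h
    have : a * W₀ * (T - t₀) ^ 2 * (T' - t₀) ^ 2 = a * W₀ * (T' - t₀) ^ 2 * (T - t₀) ^ 2 := by ring
    linarith

/-! ## 3. Slope laws for the two-letter profiles -/

/-- **SLOPE `> 1` PAST A LETTER.**  For `0 < t₀ < T`, `0 < tₖ < T` and `θ ∈ [0,1]`: `θ(T+t₀)/(T−t₀) + (1−θ)(T+tₖ)/(T−tₖ) > 1`. [folklore] -/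
theorem slope_gt_one_past {θ t₀ tk T : ℝ} (hθ0 : 0 ≤ θ) (hθ1 : θ ≤ 1) (ht₀ : 0 < t₀) (htk : 0 < tk) (hT0 : t₀ < T) (hTk : tk < T) :
    1 < θ * ((T + t₀) / (T - t₀)) + (1 - θ) * ((T + tk) / (T - tk)) := by
  have h1 : 1 < (T + t₀) / (T - t₀) := by rw [lt_div_iff₀ (by linarith)]; linarith
  have h2 : 1 < (T + tk) / (T - tk) := by rw [lt_div_iff₀ (by linarith)]; linarith
  rcases le_total ((T + t₀) / (T - t₀)) ((T + tk) / (T - tk)) with hle | hle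
  · -- the convex combination is at least the smaller value
    have : (T + t₀) / (T - t₀) ≤ θ * ((T + t₀) / (T - t₀)) + (1 - θ) * ((T + tk) / (T - tk)) := by
      nlinarith [mul_nonneg (sub_nonneg.2 hθ1) (sub_nonneg.2 hle)]
    linarith
  · have : (T + tk) / (T - tk) ≤ θ * ((T + t₀) / (T - t₀)) + (1 - θ) * ((T + tk) / (T - tk)) := by
      nlinarith [mul_nonneg hθ0 (sub_nonneg.2 hle)]
    linarith

/-- **SLOPE BOUND BEFORE A LETTER.**  For `0 < t₀ < T < tₖ` and `θ < 1`: `θ(T+t₀)/(T−t₀) + (1−θ)(T+tₖ)/(T−tₖ) < θ(T+t₀)/(T−t₀) − (1−θ)`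
(the second fraction is `< −1`). [folklore] -/
theorem slope_lt_before {θ t₀ tk T : ℝ} (hθ1 : θ < 1) (hT : 0 < T) (hTk : T < tk) :
    θ * ((T + t₀) / (T - t₀)) + (1 - θ) * ((T + tk) / (T - tk)) < θ * ((T + t₀) / (T - t₀)) - (1 - θ) := by
  have hneg : T - tk < 0 := by linarith
  have h2 : (T + tk) / (T - tk) < -1 := by
    rw [div_lt_iff_of_neg hneg]; linarith
  nlinarith

/-- **MONOTONE EXCHANGE.**  For `0 < t₀ < tⱼ < T < tₖ`, `θⱼ ∈ [0,1]`, `θₖ < 1`: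
`Sⱼ(T) − Sₖ(T) > 2(1−θₖ) − 2θₖ·t₀/(T−t₀)` (`Sₗ = θₗ(T+t₀)/(T−t₀) + (1−θₗ)(T+tₗ)/(T−tₗ)`). [folklore] -/
theorem slope_exchange {θj θk t₀ tj tk T : ℝ} (hθj0 : 0 ≤ θj) (hθj1 : θj ≤ 1) (hθk1 : θk < 1) (ht₀ : 0 < t₀)
    (htj : t₀ < tj) (hT : tj < T) (hTk : T < tk) :
    2 * (1 - θk) - 2 * θk * (t₀ / (T - t₀))
      < (θj * ((T + t₀) / (T - t₀)) + (1 - θj) * ((T + tj) / (T - tj)))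
        - (θk * ((T + t₀) / (T - t₀)) + (1 - θk) * ((T + tk) / (T - tk))) := by
  have hT0 : t₀ < T := by linarith
  have hj := slope_gt_one_past hθj0 hθj1 ht₀ (by linarith) hT0 hT
  have hk := slope_lt_before (t₀ := t₀) hθk1 (by linarith) hTk
  have hid : θk * ((T + t₀) / (T - t₀)) = θk + 2 * θk * (t₀ / (T - t₀)) := by
    have : T - t₀ ≠ 0 := by linarith
    field_simp
    ring
  linarith

/-- **… hence the later letter loses ground** as soon as `(1−θₖ)(T − t₀) ≥ θₖ t₀`, i.e. `T ≥ t₀/(1−θₖ) = t₀(a+bₖ)/a`: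
`Sₖ(T) < Sⱼ(T)`. [folklore] -/
theorem slope_exchange_pos {θj θk t₀ tj tk T : ℝ} (hθj0 : 0 ≤ θj) (hθj1 : θj ≤ 1) (hθk1 : θk < 1)
    (ht₀ : 0 < t₀) (htj : t₀ < tj) (hT : tj < T) (hTk : T < tk) (hfar : θk * t₀ ≤ (1 - θk) * (T - t₀)) :
    θk * ((T + t₀) / (T - t₀)) + (1 - θk) * ((T + tk) / (T - tk))
      < θj * ((T + t₀) / (T - t₀)) + (1 - θj) * ((T + tj) / (T - tj)) := by
  have h := slope_exchange hθj0 hθj1 hθk1 ht₀ htj hT hTk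
  have hT0 : 0 < T - t₀ := by linarith
  have hbound : 2 * θk * (t₀ / (T - t₀)) ≤ 2 * (1 - θk) := by
    rw [mul_div_assoc', div_le_iff₀ hT0]
    nlinarith
  linarith

end Summit.ValiantsHypothesis.ValiantsHypothesis.Theorems.LacunarySymmetroidMatrixDescartes.Pivot.CriticalWindows.Strip
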